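import Summits.QuantumFields.BalabanUV.Beta.GAN24.TaylorRowLamTable
import Summits.QuantumFields.BalabanUV.Beta.GAN24.E3UnitSplitLevels
import Summits.QuantumFields.BalabanUV.Beta.GAN24.StencilSlotE3PhiLeg
import Summits.QuantumFields.BalabanUV.Beta.GAN24.StencilSlotE3HLeg

/-!
# `BalabanUV.Beta.GAN24.TaylorRowLam` — binder row G-an2-4 / (CONV-C), S-slot, road «S3-Taylor», Λ SHAPE rows, part 3 of 3: THE ASSEMBLER
# (SHAPE row **S3-L** of `GAN24/StencilSlotE3OfPieces.e3Shape_of_pieces`, generic level `ℓ ≥ 0` and depth `k ≥ 0`; `θ = Lc⁻¹`)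

NOT IN PRINT; OUR PROOF ATTEMPT.  HONEST FRAMING (cell contract, verbatim): «discharging `BetaPertH` makes Bałaban's UV stability
UNCONDITIONAL — a real constructive-QFT result; it is NOT the continuum limit and NOT the Clay problem.»  HONEST DEPENDENCY (verbatim):
«continuum YM on T⁴ ⇐ BetaPertH ∧ nine spine estimates (0/9 proved); BetaPertH ⇐ (D1) ∧ (D4) ∧ CAP+tail; G-an2-4 gates asym, D1 and
NE2/3/4.»  [folklore] bookkeeping over LANDED modules BY NAME; no cited fact, no `def`, no `Prop` mirror.  ONE hypothesis of the owner's END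
(`e3Shape_of_pieces`, row `hL`) REDUCED to the two outer-leg estimates (N1) (in `StencilSlotE3HLeg`'s currency) and the top multiplier leg
(`StencilSlotE3PhiLeg`, unconditional at `d = 3`); discharges NOTHING of (hS, hSall) by itself; NOT BetaPertH, NOT continuum, NOT Clay.
Unit `b2b-balaban-gan24-formalise-leaf-18` (gen 12; ROW-Λ, cell journal l.4813), G-an2-4 formalisation swarm, 2026-08-20.

## The assembly (member `p = ℓ+k+1`, `N = Lc^p`; level `M = Lc^ℓ`, inner blocking `N′ = Lc^{ℓ+1}`; depth `R = Lc^k = N/N′`)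

1. `E3UnitSplitLevels.e3Lam_unit_split` (leaf-01): the piece is `−(cΛ/Lc^{d+1})·N^{d−2}·M^{d+3}` times the unit sandwich of
   `lagrInc d Lc M N′ = SLam N′ (lamCoeffOf (KInv N′) N′) (avgLift M ∘ hessFF Lc)`.
2. `TaylorRowLamInner.inner_eq` (part 1): inside the sandwich, the vertex block-average against the Lagrange increment is REWRITTEN EXACTLY — `cwsum` unfolded,
   the `u`-tsum exchanged with the finitely supported `Y`-sum (`TaylorMassLam.avgLift_hessFF_ne_zero`), and the vertex pairing evaluated by
   `TaylorLamVertexPairing.vertexPair_eq` (`= −𝒬ᵀ_R` of the TOP multiplier leg `wΦ_N`) — into a one-channel sandwich whose «vertex leg» is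
   `v ↦ onLat N′ (N^{d+2}·𝒬ᵀ_R Φ̃_N^{(κ′,u′)}) v` and whose table is `onLat N′ (avgLift M ∘ hessFF Lc μ)`.
3. `TaylorRowLamTable` (part 2): the hypotheses of the owner's `TaylorSandwich.sandwich_bound` for that sandwich: vertex-leg decay from `abs_contourSumAdj_le_exp`
   (`R` read-outs of a TOP-level leg), supports/radii/column mass from leaf-11's L2 (`TaylorMassLam`), lattice-point counting for the `Y`-range.
4. here: `abs_lam_piece_le`: `|piece| ≤ K·Lc^{−(d+3)}·(Lc⁻¹)^k · e^{−(κ/2)(|x′−u′|₁+|z′−u′|₁)}` with `K` free of `(ℓ, k)` — the power count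
   `N^{d−2}M^{d+3} · N^{d+2}R N^{−2(d+1)} · M^{−(d+1)} = Lc^{−(k+2)}`; §5 row S3-L at `d = 3`: `rowL_of_legs` (legs as hypotheses) and **`rowL_three`** (UNCONDITIONAL: `StencilSlotE3HLeg.legs_three` + `StencilSlotE3PhiLeg.phiLeg_three` BY NAME), `θ = Lc⁻¹`.  ROW LEMMA STATEMENT = binder `hL` of the TREE module `StencilSlotE3OfPieces.e3Shape_of_pieces` (v2 p206983; bytes of the binder = staged 2cc3c5eb8d83de1a) VERBATIM at `d = 3`, `θ := Lc⁻¹` (typer stub `S3.ShapeL 3 Lc cΛ cL θ δ`).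
-/

noncomputable section

open Finset
open scoped BigOperators
open Literature.MathematicalPhysics.QuantumFieldTheory
open Literature.MathematicalPhysics.QuantumFieldTheory.Balaban1983to89
open Literature.MathematicalPhysics.QuantumFieldTheory.Balaban1983to89.Beta
open Literature.Probability.LatticeModels (Torus.proj Torus.proj_apply)
open AffineAveraging (Site Form1 unitVec unitVec_apply)
open AffineReproduction (contourSumAdj)
open LatticeForm (quo)
open B12Sec2to5 (l1 l1_nonneg)
open ExpKernelCalculus (MKer Zl BiLoc l1_sub_triangle l1_sub_symm l1_natSmul)
open OneStepResolventKernel (Fib KInv LocStencil proj_zsmul quo_zsmul eq_zsmul_quo_of_proj KInv_inr_inr_coarse)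
open KernelSpecInstance (wH wΦ)
open KKTFluctuationKernel (GamΦ)
open InterLevelTransport (SLam avgLift cwsum cwsum_apply onLat onLat_zsmul onLat_off)
open BalabanStepJets (lamCoeffOf)
open BalabanCompositeJets (lagrInc)
open AveragingHessianKernels (hessFF ell)
open Summit.QuantumFields.BalabanUV.Beta.GAN24.E3UnitSplit (e3OfS e3OfS_inl_inr e3OfS_inr e3Lam_unit_split)
open Summit.QuantumFields.BalabanUV.Beta.GAN24.TaylorLamVertexPairing (vertexPair_eq summable_wH_mul_lamCoeffOf quo_quo
  abs_contourSumAdj_le_exp)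
open Summit.QuantumFields.BalabanUV.Beta.GAN24.TaylorSandwich (sandwich_bound)
open Summit.QuantumFields.BalabanUV.Beta.GAN24.TaylorMassLam (abs_avgLift_hessFF_le avgLift_hessFF_ne_zero)
open Summit.QuantumFields.BalabanUV.Beta.GAN24.TaylorBlockSum (abs_ediv_sub_ediv_le nonneg_of_dominated)
open Summit.QuantumFields.BalabanUV.Beta.GAN24.StencilSlotE3PhiLeg (phiLeg_three)
open Summit.QuantumFields.BalabanUV.Beta.GAN24.StencilSlotE3HLeg (legs_three)

namespace Summit.QuantumFields.BalabanUV.Beta.GAN24.TaylorRowLam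

variable {d : ℕ}

/-! ## §4 The Λ piece of level `ℓ` pushed `k` times is `≤ K·(Lc⁻¹)^k` in `LocStencil` shape (`K` free of `ℓ`, `k`) -/

section Piece

variable {Lc : ℕ} [NeZero Lc]

/-- [folklore] THE POWER COUNT of the Λ rows: `N^{d−2}·M^{d+3} · (N^{d+2}·R·N^{−2(d+1)}) · (M^{d+1}·M^{−2(d+1)}) = Lc^{−(k+2)}`
(`N = Lc^{ℓ+k+1}`, `M = Lc^ℓ`, `R = Lc^k`). -/
theorem power_count (ℓ k : ℕ) :
    ((Lc : ℝ) ^ (ℓ + k + 1)) ^ ((d : ℤ) - 2) * ((Lc : ℝ) ^ ℓ) ^ (d + 3) *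
        (((Lc : ℝ) ^ (ℓ + k + 1)) ^ (d + 2) * (Lc : ℝ) ^ k * (((Lc : ℝ) ^ (ℓ + k + 1)) ^ (2 * (d + 1)))⁻¹) *
        (((Lc : ℝ) ^ ℓ) ^ (d + 1) * (((Lc : ℝ) ^ ℓ) ^ (2 * (d + 1)))⁻¹) = ((Lc : ℝ) ^ (k + 2))⁻¹ := by
  have hL : (Lc : ℝ) ≠ 0 := by exact_mod_cast NeZero.ne Lc
  have hN : ((Lc : ℝ) ^ (ℓ + k + 1)) ≠ 0 := pow_ne_zero _ hL
  have hz : ((Lc : ℝ) ^ (ℓ + k + 1)) ^ ((d : ℤ) - 2) = ((Lc : ℝ) ^ (ℓ + k + 1)) ^ d / ((Lc : ℝ) ^ (ℓ + k + 1)) ^ 2 := by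
    rw [zpow_sub₀ hN, zpow_natCast, zpow_ofNat]
  rw [hz]
  field_simp
  ring

/-- [folklore] **THE PIECE AS A PREFACTOR TIMES THE REWRITTEN SANDWICH** (ff block): `e3Lam_unit_split` (leaf-01) followed by the inner
identity `inner_eq` under the outer legs; all blockings displayed through `((Lc^(ℓ+k+1) : ℕ) : ℝ)`. -/
theorem piece_eq_pref_mul_sandwich (cΛ : ℝ) (ℓ k p : ℕ) (hp : p = ℓ + k + 1) (κ' : Fin (d + 1)) (u' x' z' : Site (d + 1)) (α β : Fin (d + 1)) :
    ((Lc : ℝ) ^ p) ^ (2 * (d + 1)) *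
        e3OfS (Lc ^ p) (fun κ u => (((Lc : ℝ) ^ (d + 1)) ^ k * (cΛ * ((Lc : ℝ) ^ ℓ) ^ (2 * d + 4))) •
          lagrInc d Lc (Lc ^ ℓ) (Lc ^ (ℓ + 1)) κ u) κ' u' x' z' (Sum.inl α) (Sum.inl β) =
      -(cΛ / (Lc : ℝ) ^ (d + 1)) * (((Lc ^ p : ℕ) : ℝ)) ^ ((d : ℤ) - 2) * ((Lc : ℝ) ^ ℓ) ^ (d + 3) *
        ∑' y : Site (d + 1), ∑ l' : Fin (d + 1),
          (∑' w : Site (d + 1), ∑ l : Fin (d + 1),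
              ((((Lc ^ p : ℕ) : ℝ)) ^ (d + 2) * GamΦ (N := Lc ^ p) α x' l w) *
                ∑ μ : Fin (d + 1), ((((Lc ^ p : ℕ) : ℝ)) ^ (d + 1))⁻¹ * ∑' v : Site (d + 1),
                  onLat (Lc ^ (ℓ + 1)) (fun Y => (((Lc ^ p : ℕ) : ℝ)) ^ (d + 2) *
                      contourSumAdj (Lc ^ k) (fun κ₁ q => wΦ (N := Lc ^ p) κ₁ κ' (q - u')) μ Y) v *
                    onLat (Lc ^ (ℓ + 1)) (fun Y => avgLift (Lc ^ ℓ) (hessFF Lc μ Y)) v w y (Sum.inl l) (Sum.inl l')) *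
            ((((Lc ^ p : ℕ) : ℝ)) ^ (d + 2) *
              wH (N := Lc ^ p) l' β (y - ((Lc ^ p : ℕ) : ℤ) • z')) := by
  subst hp
  haveI hN0 : NeZero (Lc ^ (ℓ + k + 1)) := ⟨pow_ne_zero _ (NeZero.ne Lc)⟩
  haveI hNp0 : NeZero (Lc ^ (ℓ + 1)) := ⟨pow_ne_zero _ (NeZero.ne Lc)⟩
  haveI hM0 : NeZero (Lc ^ ℓ) := ⟨pow_ne_zero _ (NeZero.ne Lc)⟩
  have hNR : Lc ^ (ℓ + k + 1) = Lc ^ (ℓ + 1) * Lc ^ k := by rw [← pow_add]; ring_nf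
  have hcast : (((Lc ^ (ℓ + k + 1) : ℕ) : ℝ)) = (Lc : ℝ) ^ (ℓ + k + 1) := by push_cast; rfl
  rw [e3Lam_unit_split cΛ ℓ k (ℓ + k + 1) rfl κ' u' x' z' α β, ← hcast]
  have hin := fun w y l l' => inner_eq (d := d) (Lc := Lc) (N := Lc ^ (ℓ + k + 1)) (N' := Lc ^ (ℓ + 1)) (M := Lc ^ ℓ)
    (R := Lc ^ k) hNR κ' u' w y l l'
  congr 1
  refine tsum_congr fun y => Finset.sum_congr rfl fun l' _ => ?_
  congr 1
  refine tsum_congr fun w => Finset.sum_congr rfl fun l _ => ?_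
  congr 1
  exact hin w y l l'

/-- [folklore] **THE Λ PIECE OF LEVEL `ℓ` PUSHED `k` TIMES** (member `N = Lc^{ℓ+k+1}`): with the two OUTER legs of the sandwich bounded in
`StencilSlotE3HLeg`'s block-`ℓ¹` currency at rate `κ` ((N1): `|N^{d+2}·GamΦ_N α x′ l w| ≤ CA·e^{−κ|x′−quo N w|₁}`, `|N^{d+2}·wH_N κ l z| ≤
CB·e^{−κ|quo N z|₁}`) and the TOP multiplier leg in the K-slot currency (`|N^{2(d+1)}·wΦ_N κ l y| ≤ CΦ·e^{−κ|y|₁}`, `StencilSlotE3PhiLeg`),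
the normalised third-jet piece is bounded in the `BiLoc … u′ u′` shape of `LocStencil` by an EXPLICIT `(ℓ,k)`-free constant times
`(Lc⁻¹)^k`, at rate `κ/2`.  Inputs: `e3Lam_unit_split` (leaf-01), `inner_eq` (§2: the exact vertex pairing), `TaylorSandwich.sandwich_bound`
(owner), `TaylorMassLam` (leaf-11), `power_count`. -/
theorem abs_lam_piece_le (cΛ : ℝ) (ℓ k p : ℕ) (hp : p = ℓ + k + 1) {κ CA CB CΦ : ℝ} (hκ : 0 < κ) (hCΦ : 0 ≤ CΦ)
    (hA : ∀ (α l : Fin (d + 1)) (x' w : Site (d + 1)),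
      |((Lc : ℝ) ^ p) ^ (d + 2) * GamΦ (N := Lc ^ p) α x' l w| ≤
        CA * Real.exp (-κ * l1 (x' - quo (Lc ^ p) w)))
    (hB : ∀ (κ₁ l : Fin (d + 1)) (z : Site (d + 1)),
      |((Lc : ℝ) ^ p) ^ (d + 2) * wH (N := Lc ^ p) κ₁ l z| ≤ CB * Real.exp (-κ * l1 (quo (Lc ^ p) z)))
    (hΦ : ∀ (κ₁ l : Fin (d + 1)) (y : Site (d + 1)),
      |((Lc : ℝ) ^ p) ^ (2 * (d + 1)) * wΦ (N := Lc ^ p) κ₁ l y| ≤ CΦ * Real.exp (-κ * l1 y))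
    (κ' : Fin (d + 1)) (u' x' z' : Site (d + 1)) (a b : Fib d) :
    |((Lc : ℝ) ^ p) ^ (2 * (d + 1)) *
        e3OfS (Lc ^ p) (fun κ u => (((Lc : ℝ) ^ (d + 1)) ^ k * (cΛ * ((Lc : ℝ) ^ ℓ) ^ (2 * d + 4))) •
          lagrInc d Lc (Lc ^ ℓ) (Lc ^ (ℓ + 1)) κ u) κ' u' x' z' a b| ≤
      |cΛ| / (Lc : ℝ) ^ (d + 1) *
        (((d : ℝ) + 1) * (CA * CB * (CΦ * Real.exp κ) * ((((8 * (d + 1) * (Lc + 1) + 1 : ℕ) : ℝ) ^ (d + 1)) * (((d : ℝ) + 1) * (((d : ℝ) + 1) *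
      ((((2 * (4 * (d + 1) + 1) + 1) ^ (d + 1) : ℕ) : ℝ) * (2 * (ell (d + 1) Lc : ℝ) ^ 2))))) *
          (Real.exp (κ * (((d : ℝ) + 1) * (4 * ((d : ℝ) + 1) * (Lc + 1)) + (d + 1))) *
            Real.exp (κ * (((d : ℝ) + 1) * ((4 * ((d : ℝ) + 1) + 1) + 1) + (d + 1))))) *
          Zl (d + 1) (κ / 2)) *
        ((Lc : ℝ) ^ (k + 2))⁻¹ * Real.exp (-(κ / 2) * (l1 (x' - u') + l1 (z' - u'))) := by
  subst hp
  have hL0 : (0 : ℝ) < Lc := by exact_mod_cast Nat.pos_of_ne_zero (NeZero.ne Lc)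
  have hL1 : (1 : ℝ) ≤ Lc := by exact_mod_cast (Nat.one_le_iff_ne_zero.2 (NeZero.ne Lc))
  have hcast : (((Lc ^ (ℓ + k + 1) : ℕ) : ℝ)) = (Lc : ℝ) ^ (ℓ + k + 1) := by push_cast; rfl
  have hNpos : (0 : ℝ) < ((Lc ^ (ℓ + k + 1) : ℕ) : ℝ) := by rw [hcast]; positivity
  have hCA : 0 ≤ CA := nonneg_of_dominated (Real.exp_pos _) (hA 0 0 x' 0)
  have hCB : 0 ≤ CB := nonneg_of_dominated (Real.exp_pos _) (hB 0 0 0)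
  have hZl : 0 ≤ Zl (d + 1) (κ / 2) := by unfold ExpKernelCalculus.Zl; exact tsum_nonneg fun _ => (Real.exp_pos _).le
  -- the zero blocks
  rcases a with α | ν
  swap
  · rw [e3OfS_inr, mul_zero, abs_zero]; positivity
  rcases b with β | ν'
  swap
  · rw [e3OfS_inl_inr, mul_zero, abs_zero]; positivity
  -- the ff block
  rw [piece_eq_pref_mul_sandwich cΛ ℓ k (ℓ + k + 1) rfl, abs_mul]
  refine (mul_le_mul_of_nonneg_left (abs_sandwich_le ℓ k (ℓ + k + 1) rfl hκ hCΦ hA hB hΦ κ' u' x' z' α β) (abs_nonneg _)).trans ?_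
  have habs : |-(cΛ / (Lc : ℝ) ^ (d + 1)) * (((Lc ^ (ℓ + k + 1) : ℕ) : ℝ)) ^ ((d : ℤ) - 2) * ((Lc : ℝ) ^ ℓ) ^ (d + 3)| =
      |cΛ| / (Lc : ℝ) ^ (d + 1) * ((((Lc ^ (ℓ + k + 1) : ℕ) : ℝ)) ^ ((d : ℤ) - 2) * ((Lc : ℝ) ^ ℓ) ^ (d + 3)) := by
    rw [abs_mul, abs_mul, abs_neg, abs_div, abs_of_pos (pow_pos hL0 _), abs_of_pos (zpow_pos hNpos _),
      abs_of_pos (pow_pos (pow_pos hL0 _) _), mul_assoc]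
  rw [habs]
  -- the power count
  have hSw : (((2 * (2 * (2 * (d + 1) * (Lc + 1) * Lc ^ ℓ)) + 1) ^ (d + 1) : ℕ) : ℝ) ≤ (((8 * (d + 1) * (Lc + 1) + 1 : ℕ) : ℝ) ^ (d + 1)) * ((Lc : ℝ) ^ ℓ) ^ (d + 1) := by
    rw [← mul_pow]
    push_cast
    refine pow_le_pow_left₀ (by positivity) ?_ _
    have hM1 : (1 : ℝ) ≤ (Lc : ℝ) ^ ℓ := one_le_pow₀ hL1
    nlinarith [hM1, show (0 : ℝ) ≤ 8 * ((d : ℝ) + 1) * (Lc + 1) by positivity]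
  have hPC := power_count (d := d) (Lc := Lc) ℓ k
  set M0 : ℝ := ((d : ℝ) + 1) * (((d : ℝ) + 1) *
      ((((2 * (4 * (d + 1) + 1) + 1) ^ (d + 1) : ℕ) : ℝ) * (2 * (ell (d + 1) Lc : ℝ) ^ 2))) with hM0
  have hM0' : 0 ≤ M0 := by positivity
  set PP : ℝ := ((Lc : ℝ) ^ (ℓ + k + 1)) ^ ((d : ℤ) - 2) * ((Lc : ℝ) ^ ℓ) ^ (d + 3) *
      (((Lc : ℝ) ^ (ℓ + k + 1)) ^ (d + 2) * (Lc : ℝ) ^ k * (((Lc : ℝ) ^ (ℓ + k + 1)) ^ (2 * (d + 1)))⁻¹) *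
      (((Lc : ℝ) ^ ℓ) ^ (2 * (d + 1)))⁻¹ with hPP
  have hPP' : 0 ≤ PP := by
    rw [hPP]
    exact mul_nonneg (mul_nonneg (mul_nonneg (zpow_pos (by positivity) _).le (by positivity)) (by positivity)) (by positivity)
  have key : (((Lc ^ (ℓ + k + 1) : ℕ) : ℝ)) ^ ((d : ℤ) - 2) * ((Lc : ℝ) ^ ℓ) ^ (d + 3) *
      (((((Lc ^ (ℓ + k + 1) : ℕ) : ℝ)) ^ (d + 2) * ((Lc : ℝ) ^ k * ((CΦ * (((Lc : ℝ) ^ (ℓ + k + 1)) ^ (2 * (d + 1)))⁻¹) * Real.exp κ))) *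
          ((((2 * (2 * (2 * (d + 1) * (Lc + 1) * Lc ^ ℓ)) + 1) ^ (d + 1) : ℕ) : ℝ) * (((d : ℝ) + 1) * (((d : ℝ) + 1) *
            ((((2 * (4 * (d + 1) + 1) + 1) ^ (d + 1) : ℕ) : ℝ) * (2 * (ell (d + 1) Lc : ℝ) ^ 2 / ((Lc : ℝ) ^ ℓ) ^ (2 * (d + 1)))))))) ≤
      (CΦ * Real.exp κ) * ((((8 * (d + 1) * (Lc + 1) + 1 : ℕ) : ℝ) ^ (d + 1)) * M0) * ((Lc : ℝ) ^ (k + 2))⁻¹ := by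
    rw [hcast]
    calc ((Lc : ℝ) ^ (ℓ + k + 1)) ^ ((d : ℤ) - 2) * ((Lc : ℝ) ^ ℓ) ^ (d + 3) *
      ((((Lc : ℝ) ^ (ℓ + k + 1)) ^ (d + 2) * ((Lc : ℝ) ^ k * ((CΦ * (((Lc : ℝ) ^ (ℓ + k + 1)) ^ (2 * (d + 1)))⁻¹) * Real.exp κ))) *
          ((((2 * (2 * (2 * (d + 1) * (Lc + 1) * Lc ^ ℓ)) + 1) ^ (d + 1) : ℕ) : ℝ) * (((d : ℝ) + 1) * (((d : ℝ) + 1) *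
            ((((2 * (4 * (d + 1) + 1) + 1) ^ (d + 1) : ℕ) : ℝ) * (2 * (ell (d + 1) Lc : ℝ) ^ 2 / ((Lc : ℝ) ^ ℓ) ^ (2 * (d + 1))))))))
        = (CΦ * Real.exp κ) * M0 * ((((2 * (2 * (2 * (d + 1) * (Lc + 1) * Lc ^ ℓ)) + 1) ^ (d + 1) : ℕ) : ℝ) * PP) := by
          rw [hM0, hPP]; ring
      _ ≤ (CΦ * Real.exp κ) * M0 * (((((8 * (d + 1) * (Lc + 1) + 1 : ℕ) : ℝ) ^ (d + 1)) * ((Lc : ℝ) ^ ℓ) ^ (d + 1)) * PP) :=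
          mul_le_mul_of_nonneg_left (mul_le_mul_of_nonneg_right hSw hPP') (by positivity)
      _ = (CΦ * Real.exp κ) * ((((8 * (d + 1) * (Lc + 1) + 1 : ℕ) : ℝ) ^ (d + 1)) * M0) *
          (((Lc : ℝ) ^ (ℓ + k + 1)) ^ ((d : ℤ) - 2) * ((Lc : ℝ) ^ ℓ) ^ (d + 3) *
            (((Lc : ℝ) ^ (ℓ + k + 1)) ^ (d + 2) * (Lc : ℝ) ^ k * (((Lc : ℝ) ^ (ℓ + k + 1)) ^ (2 * (d + 1)))⁻¹) *
            (((Lc : ℝ) ^ ℓ) ^ (d + 1) * (((Lc : ℝ) ^ ℓ) ^ (2 * (d + 1)))⁻¹)) := by rw [hPP]; ring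
      _ = _ := by rw [hPC]
  -- final assembly
  set F : ℝ := |cΛ| / (Lc : ℝ) ^ (d + 1) * (((d : ℝ) + 1) * (CA * CB)) *
      (Real.exp (κ * (((d : ℝ) + 1) * (4 * ((d : ℝ) + 1) * (Lc + 1)) + (d + 1))) *
            Real.exp (κ * (((d : ℝ) + 1) * ((4 * ((d : ℝ) + 1) + 1) + 1) + (d + 1)))) *
      Zl (d + 1) (κ / 2) * Real.exp (-(κ / 2) * (l1 (x' - u') + l1 (z' - u'))) with hF
  have hF0 : 0 ≤ F := by rw [hF]; positivity
  calc |cΛ| / (Lc : ℝ) ^ (d + 1) * ((((Lc ^ (ℓ + k + 1) : ℕ) : ℝ)) ^ ((d : ℤ) - 2) * ((Lc : ℝ) ^ ℓ) ^ (d + 3)) *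
      (((d : ℝ) + 1) * (CA * CB *
          ((((Lc ^ (ℓ + k + 1) : ℕ) : ℝ)) ^ (d + 2) * ((Lc : ℝ) ^ k * ((CΦ * (((Lc : ℝ) ^ (ℓ + k + 1)) ^ (2 * (d + 1)))⁻¹) * Real.exp κ))) *
          ((((2 * (2 * (2 * (d + 1) * (Lc + 1) * Lc ^ ℓ)) + 1) ^ (d + 1) : ℕ) : ℝ) * (((d : ℝ) + 1) * (((d : ℝ) + 1) *
            ((((2 * (4 * (d + 1) + 1) + 1) ^ (d + 1) : ℕ) : ℝ) * (2 * (ell (d + 1) Lc : ℝ) ^ 2 / ((Lc : ℝ) ^ ℓ) ^ (2 * (d + 1))))))) *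
          (Real.exp (κ * (((d : ℝ) + 1) * (4 * ((d : ℝ) + 1) * (Lc + 1)) + (d + 1))) *
            Real.exp (κ * (((d : ℝ) + 1) * ((4 * ((d : ℝ) + 1) + 1) + 1) + (d + 1))))) *
        Zl (d + 1) (κ / 2) * Real.exp (-(κ / 2) * (l1 (x' - u') + l1 (z' - u'))))
      = F * ((((Lc ^ (ℓ + k + 1) : ℕ) : ℝ)) ^ ((d : ℤ) - 2) * ((Lc : ℝ) ^ ℓ) ^ (d + 3) *
      (((((Lc ^ (ℓ + k + 1) : ℕ) : ℝ)) ^ (d + 2) * ((Lc : ℝ) ^ k * ((CΦ * (((Lc : ℝ) ^ (ℓ + k + 1)) ^ (2 * (d + 1)))⁻¹) * Real.exp κ))) *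
          ((((2 * (2 * (2 * (d + 1) * (Lc + 1) * Lc ^ ℓ)) + 1) ^ (d + 1) : ℕ) : ℝ) * (((d : ℝ) + 1) * (((d : ℝ) + 1) *
            ((((2 * (4 * (d + 1) + 1) + 1) ^ (d + 1) : ℕ) : ℝ) * (2 * (ell (d + 1) Lc : ℝ) ^ 2 / ((Lc : ℝ) ^ ℓ) ^ (2 * (d + 1))))))))) := by
        rw [hF]; ring
    _ ≤ F * ((CΦ * Real.exp κ) * ((((8 * (d + 1) * (Lc + 1) + 1 : ℕ) : ℝ) ^ (d + 1)) * M0) * ((Lc : ℝ) ^ (k + 2))⁻¹) :=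
        mul_le_mul_of_nonneg_left key hF0
    _ = _ := by rw [hF, hM0]; ring

end Piece

/-! ## §5 Row S3-L of the SHAPE table at `d = 3` (`θ = Lc⁻¹`): the hypothesis `hL` of `StencilSlotE3OfPieces.e3Shape_of_pieces` -/

section Row

variable {Lc : ℕ} [NeZero Lc]

omit [NeZero Lc] in
/-- [folklore] `(Lc^(k+2))⁻¹ = (Lc^2)⁻¹·(Lc⁻¹)^k`. -/
theorem inv_pow_succ_succ (k : ℕ) : ((Lc : ℝ) ^ (k + 2))⁻¹ = ((Lc : ℝ) ^ 2)⁻¹ * ((Lc : ℝ)⁻¹) ^ k := by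
  rw [pow_add, mul_inv, inv_pow, mul_comm]

/-- [folklore] **ROW S3-L OF THE SHAPE TABLE** (`d = 3`; the hypothesis `hL` of the owner's END `StencilSlotE3OfPieces.e3Shape_of_pieces`
∕ the typer's `S3.ShapeL 3 Lc cΛ cL θ δ` VERBATIM, with `θ = Lc⁻¹`, `δ = κ/2`): GIVEN the two outer legs of every member in
`StencilSlotE3HLeg.legs_three`'s currency (`hN1`, `hG`; (N1) = leaf-16's `FineReadoutDecay` underneath) and the top multiplier leg in
`StencilSlotE3PhiLeg.phiLeg_three`'s currency (`hΦ`; the K-slot underneath, unconditional at `d = 3`), the Λ increment of level `m+1` pushed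
`n − m` times is a local stencil family with constant `cL·(Lc⁻¹)^{n−m}`, `cL` free of `(n, m)`.  Row S3-L is thereby REDUCED IN THE KERNEL to
those two leg modules; nothing else is assumed. -/
theorem rowL_of_legs (cΛ : ℝ) {κ CH CΦ : ℝ} (hκ : 0 < κ) (hCΦ : 0 ≤ CΦ)
    (hN1 : ∀ (j : ℕ) (κ₁ l : Fin (3 + 1)) (z : Site (3 + 1)),
      |((Lc : ℝ) ^ (j + 1)) ^ (3 + 2) * wH (N := Lc ^ (j + 1)) κ₁ l z| ≤ CH * Real.exp (-κ * l1 (quo (Lc ^ (j + 1)) z)))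
    (hG : ∀ (j : ℕ) (α l : Fin (3 + 1)) (x' w : Site (3 + 1)),
      |((Lc : ℝ) ^ (j + 1)) ^ (3 + 2) * GamΦ (N := Lc ^ (j + 1)) α x' l w| ≤
        CH * Real.exp (-κ * l1 (x' - quo (Lc ^ (j + 1)) w)))
    (hΦ : ∀ (j : ℕ) (κ₁ l : Fin (3 + 1)) (y : Site (3 + 1)),
      |((Lc : ℝ) ^ (j + 1)) ^ (2 * (3 + 1)) * wΦ (N := Lc ^ (j + 1)) κ₁ l y| ≤ CΦ * Real.exp (-κ * l1 y)) :
    ∃ cL : ℝ, ∀ n m : ℕ, m < n → LocStencil (fun κ' u' x' z' a b => ((Lc : ℝ) ^ (n + 1 + 1)) ^ (2 * (3 + 1)) *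
      e3OfS (Lc ^ (n + 1 + 1)) (fun κ u => (((Lc : ℝ) ^ (3 + 1)) ^ (n - m) * (cΛ * ((Lc : ℝ) ^ (m + 1)) ^ (2 * 3 + 4))) •
        lagrInc 3 Lc (Lc ^ (m + 1)) (Lc ^ (m + 1 + 1)) κ u) κ' u' x' z' a b) (cL * ((Lc : ℝ)⁻¹) ^ (n - m)) (κ / 2) := by
  refine ⟨|cΛ| / (Lc : ℝ) ^ (3 + 1) *
        ((((3 : ℕ) : ℝ) + 1) * (CH * CH * (CΦ * Real.exp κ) * ((((8 * (3 + 1) * (Lc + 1) + 1 : ℕ) : ℝ) ^ (3 + 1)) * ((((3 : ℕ) : ℝ) + 1) * ((((3 : ℕ) : ℝ) + 1) *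
      ((((2 * (4 * (3 + 1) + 1) + 1) ^ (3 + 1) : ℕ) : ℝ) * (2 * (ell (3 + 1) Lc : ℝ) ^ 2))))) *
          (Real.exp (κ * ((((3 : ℕ) : ℝ) + 1) * (4 * (((3 : ℕ) : ℝ) + 1) * (Lc + 1)) + (((3:ℕ):ℝ) + 1))) *
            Real.exp (κ * ((((3 : ℕ) : ℝ) + 1) * ((4 * (((3 : ℕ) : ℝ) + 1) + 1) + 1) + (((3:ℕ):ℝ) + 1))))) *
          Zl (3 + 1) (κ / 2)) * ((Lc : ℝ) ^ 2)⁻¹, fun n m hmn κ' u' x' z' a b => ?_⟩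
  have h := abs_lam_piece_le (d := 3) (Lc := Lc) cΛ (m + 1) (n - m) (n + 1 + 1) (by omega) hκ hCΦ
    (fun α l x' w => hG (n + 1) α l x' w) (fun κ₁ l z => hN1 (n + 1) κ₁ l z) (fun κ₁ l y => hΦ (n + 1) κ₁ l y) κ' u' x' z' a b
  rw [inv_pow_succ_succ] at h
  refine h.trans (le_of_eq ?_)
  push_cast
  ring

/-- [folklore] Weakening of an exponential rate: `C·e^{−a t} ≤ C·e^{−b t}` for `b ≤ a`, `t ≥ 0`, `C ≥ 0`. -/
theorem mul_exp_mono_rate {C a b t : ℝ} (hC : 0 ≤ C) (hba : b ≤ a) (ht : 0 ≤ t) :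
    C * Real.exp (-a * t) ≤ C * Real.exp (-b * t) :=
  mul_le_mul_of_nonneg_left (Real.exp_le_exp.mpr (by nlinarith)) hC

/-- [folklore] **ROW S3-L OF THE SHAPE TABLE, UNCONDITIONALLY AT `d = 3`** (every `Lc` with `NeZero Lc`): the hypothesis `hL` of
`StencilSlotE3OfPieces.e3Shape_of_pieces` ∕ `S3.ShapeL 3 Lc cΛ cL θ δ`, with `θ = Lc⁻¹`, from the TREE theorems `StencilSlotE3HLeg.legs_three`
((N1) `FineReadoutDecay` inside) and `StencilSlotE3PhiLeg.phiLeg_three` (the K-slot inside) at the common rate `min κ δ`.  Discharges ONE of the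
twelve per-piece estimates of the S-slot table; NOT (hS, hSall) by itself, NOT BetaPertH, NOT continuum, NOT Clay. -/
theorem rowL_three (cΛ : ℝ) : ∃ cL δL : ℝ, 0 < δL ∧ ∀ n m : ℕ, m < n →
    LocStencil (fun κ' u' x' z' a b => ((Lc : ℝ) ^ (n + 1 + 1)) ^ (2 * (3 + 1)) *
      e3OfS (Lc ^ (n + 1 + 1)) (fun κ u => (((Lc : ℝ) ^ (3 + 1)) ^ (n - m) * (cΛ * ((Lc : ℝ) ^ (m + 1)) ^ (2 * 3 + 4))) •
        lagrInc 3 Lc (Lc ^ (m + 1)) (Lc ^ (m + 1 + 1)) κ u) κ' u' x' z' a b) (cL * ((Lc : ℝ)⁻¹) ^ (n - m)) δL := by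
  obtain ⟨CH, κ, hκ, hCH, hH, hG⟩ := legs_three (Lc := Lc)
  obtain ⟨CΦ, δ, hδ, hCΦ, hΦ1, -⟩ := phiLeg_three (Lc := Lc)
  set ρ : ℝ := min κ δ with hρ
  have hρ0 : 0 < ρ := lt_min hκ hδ
  have hρκ : ρ ≤ κ := min_le_left _ _
  have hρδ : ρ ≤ δ := min_le_right _ _
  have hN1 : ∀ (j : ℕ) (κ₁ l : Fin (3 + 1)) (z : Site (3 + 1)),
      |((Lc : ℝ) ^ (j + 1)) ^ (3 + 2) * wH (N := Lc ^ (j + 1)) κ₁ l z| ≤ CH * Real.exp (-ρ * l1 (quo (Lc ^ (j + 1)) z)) := by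
    intro j κ₁ l z
    have h := hH j κ₁ l z 0
    rw [smul_zero, sub_zero, sub_zero] at h
    exact h.trans (mul_exp_mono_rate hCH hρκ (l1_nonneg _))
  have hG' : ∀ (j : ℕ) (α l : Fin (3 + 1)) (x' w : Site (3 + 1)),
      |((Lc : ℝ) ^ (j + 1)) ^ (3 + 2) * GamΦ (N := Lc ^ (j + 1)) α x' l w| ≤
        CH * Real.exp (-ρ * l1 (x' - quo (Lc ^ (j + 1)) w)) := fun j α l x' w =>
    (hG j α l x' w).trans (mul_exp_mono_rate hCH hρκ (l1_nonneg _))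
  have hΦ : ∀ (j : ℕ) (κ₁ l : Fin (3 + 1)) (y : Site (3 + 1)),
      |((Lc : ℝ) ^ (j + 1)) ^ (2 * (3 + 1)) * wΦ (N := Lc ^ (j + 1)) κ₁ l y| ≤ CΦ * Real.exp (-ρ * l1 y) := by
    intro j κ₁ l y
    haveI : NeZero (Lc ^ (j + 1)) := ⟨pow_ne_zero _ (NeZero.ne Lc)⟩
    have h := hΦ1 j y (((Lc ^ (j + 1) : ℕ) : ℤ) • (0 : Site (3 + 1))) κ₁ l
    rw [KInv_inr_inr_coarse, quo_zsmul, sub_zero] at h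
    exact h.trans (mul_exp_mono_rate hCΦ hρδ (l1_nonneg _))
  obtain ⟨cL, hcL⟩ := rowL_of_legs (Lc := Lc) cΛ hρ0 hCΦ hN1 hG' hΦ
  exact ⟨cL, ρ / 2, half_pos hρ0, hcL⟩

end Row

end Summit.QuantumFields.BalabanUV.Beta.GAN24.TaylorRowLam
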